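import Summits.QuantumFields.QCD.Theorems.SpectralDefectExtinctionWegnerEstimateCoareaCircleShape
import Literature.MathematicalPhysics.QuantumLattice.SpectralLocalizer

/-!
# Single-link resonance (S2c of line `corner-decorrelation-deep-hole`): the fermion determinant along a
one-link circle is the modulus of a polynomial on the unit circle
(crux `Summit.QuantumFields.QCD.Theses.SpectralDefectExtinction.WindowExtinction`, item stmt-QuantumFields-18063)

Brick B of the registered stub `stub_singleLinkResonance`.  Rotating ONE link `e = (z, μ)` of a gauge
field `W` along a degree-one trigonometric curve `c(t) = δ₀ + cos t δ₁ + sin t δ₂` in `SU(3)` (every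
one-parameter circle `exp(tX)` of the eight `su(3)` basis directions is of this form,
`coareaWegner_su3Circles`), the phase-quenched fermion weight is

  `∏_f ‖det D_W(W[e ↦ W(e)c(t)], μ_f, 1)‖ = ‖Q(e^{it})‖`     (`cornerSL_prod_fermionDet_circle_poly`)

for a complex polynomial `Q` of degree `≤ 48 N_f`, uniformly in the torus side, the field and the masses.
Proof: `det D_W = ± det (Γ₅ D_W)` (`‖det Γ₅‖ = 1`); along the circle `Γ₅ D_W` moves inside a rank-`24`
pencil, `det (Γ₅ D_W(t)) = det (A + B (Δ₀ + cos t Δ₁ + sin t Δ₂) C)` (the landed bridge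
`coareaWegner_oneLinkCircle_detShape`), and `e^{24it} det (A + B Δ(t) C) = P(e^{it})` with `deg P ≤ 48`
(block determinant with the last `24` rows multiplied by `z = e^{it}`; adapted from the tree file
`…WegnerEstimateStubCircleZeroCount`, where this step is private).  This is the input `Q` of the weight
sup bound `cornerSL_weight_sup` (brick A).
-/

noncomputable section

namespace Summit.QuantumFields.QCD.Cruxes.WindowExtinction.CornerDecorrelationDeepHole

open scoped BigOperators Matrix Polynomial
open Matrix
open Literature.MathematicalPhysics.QuantumLattice Literature.MathematicalPhysics.QuantumFieldTheory
  Literature.Probability.LatticeModels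
open Summit.QuantumFields.QCD.Cruxes.WegnerEstimate.ResolventCell (coareaWegner_oneLinkCircle_detShape)

/-! ### The pencil determinant is a polynomial on the circle
(adapted from `Summits/QuantumFields/QCD/Theorems/SpectralDefectExtinctionWegnerEstimateStubCircleZeroCount.lean`,
where these three lemmas are private) -/

/-- Row-wise degree count for the determinant of a polynomial matrix: if the entries of row `i` have
degree `≤ d i`, then `deg det M ≤ ∑ i, d i` (Leibniz expansion). -/
theorem cornerSL_natDegree_det_le_of_row {n : Type*} [Fintype n] [DecidableEq n]
    (M : Matrix n n ℂ[X]) (d : n → ℕ) (hM : ∀ i j, (M i j).natDegree ≤ d i) :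
    M.det.natDegree ≤ ∑ i, d i := by
  rw [Matrix.det_apply]
  refine Polynomial.natDegree_sum_le_of_forall_le _ _ fun σ _ => ?_
  refine (Polynomial.natDegree_smul_le _ _).trans ((Polynomial.natDegree_prod_le _ _).trans ?_)
  calc ∑ i, (M (σ i) i).natDegree ≤ ∑ i, d (σ i) := Finset.sum_le_sum fun i _ => hM _ _
    _ = ∑ i, d i := Equiv.sum_comp σ d

/-- `z cos t = (z² + 1)/2` for `z = e^{it}`. -/
theorem cornerSL_exp_mul_cos (t : ℝ) :
    (1 / 2 : ℂ) * (Complex.exp (↑t * Complex.I) ^ 2 + 1) =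
      Complex.exp (↑t * Complex.I) * ((Real.cos t : ℝ) : ℂ) := by
  rw [Complex.ofReal_cos, Complex.exp_mul_I]
  linear_combination (-(1 : ℂ) / 2) * Complex.cos_sq_add_sin_sq (t : ℂ) +
    (Complex.sin t ^ 2 / 2) * Complex.I_sq

/-- `z sin t = −(i/2)(z² − 1)` for `z = e^{it}`. -/
theorem cornerSL_exp_mul_sin (t : ℝ) :
    -(Complex.I / 2) * (Complex.exp (↑t * Complex.I) ^ 2 - 1) =
      Complex.exp (↑t * Complex.I) * ((Real.sin t : ℝ) : ℂ) := by
  rw [Complex.ofReal_sin, Complex.exp_mul_I]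
  linear_combination (-Complex.I / 2) * Complex.cos_sq_add_sin_sq (t : ℂ) +
    (-(Complex.I / 2) * Complex.sin t ^ 2 - Complex.cos t * Complex.sin t) * Complex.I_sq

/-- `z ^ r · det (A + B Δ(t) C) = P(z)` at `z = e^{it}` for a polynomial `P` of degree `≤ 2r`
(block determinant with the last `r` rows multiplied by `z`). -/
theorem cornerSL_exists_poly_det (N r : ℕ) (A : Matrix (Fin N) (Fin N) ℂ) (B : Matrix (Fin N) (Fin r) ℂ)
    (C : Matrix (Fin r) (Fin N) ℂ) (δ₀ δ₁ δ₂ : Matrix (Fin r) (Fin r) ℂ) :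
    ∃ P : ℂ[X], P.natDegree ≤ 2 * r ∧ ∀ t : ℝ, P.eval (Complex.exp (↑t * Complex.I)) =
      Complex.exp (↑t * Complex.I) ^ r *
        (A + B * (δ₀ + ((Real.cos t : ℝ) : ℂ) • δ₁ + ((Real.sin t : ℝ) : ℂ) • δ₂) * C).det := by
  -- `z Δ(t)` as a polynomial matrix in `z`
  obtain ⟨ΔX, hΔX⟩ : ∃ ΔX : Matrix (Fin r) (Fin r) ℂ[X], ΔX =
      (Polynomial.X : ℂ[X]) • δ₀.map Polynomial.C +
        (Polynomial.C (1 / 2 : ℂ) * (Polynomial.X ^ 2 + 1)) • δ₁.map Polynomial.C +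
        (Polynomial.C (-(Complex.I / 2)) * (Polynomial.X ^ 2 - 1)) • δ₂.map Polynomial.C := ⟨_, rfl⟩
  -- the block matrix `[[A, -B], [z Δ(t) C, z · 1]]`
  obtain ⟨M, hM⟩ : ∃ M : Matrix (Fin N ⊕ Fin r) (Fin N ⊕ Fin r) ℂ[X], M =
      Matrix.fromBlocks (A.map Polynomial.C) (-B.map Polynomial.C) (ΔX * C.map Polynomial.C)
        ((Polynomial.X : ℂ[X]) • (1 : Matrix (Fin r) (Fin r) ℂ[X])) := ⟨_, rfl⟩
  have hΔdeg : ∀ i k, (ΔX i k).natDegree ≤ 2 := by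
    intro i k
    rw [hΔX]
    simp only [Matrix.add_apply, Matrix.smul_apply, Matrix.map_apply, smul_eq_mul]
    compute_degree!
  refine ⟨M.det, ?_, fun t => ?_⟩
  · -- degree count: rows `inl _` are constant, rows `inr _` have degree `≤ 2`
    refine (cornerSL_natDegree_det_le_of_row M (Sum.elim (fun _ => 0) (fun _ => 2)) ?_).trans (le_of_eq ?_)
    · rintro (i | i) (j | j)
      · simp [hM]
      · simp [hM]
      · simp only [hM, Matrix.fromBlocks_apply₂₁, Sum.elim_inr, Matrix.mul_apply, Matrix.map_apply]
        exact Polynomial.natDegree_sum_le_of_forall_le _ _ fun k _ =>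
          (Polynomial.natDegree_mul_C_le _ _).trans (hΔdeg i k)
      · simp only [hM, Matrix.fromBlocks_apply₂₂, Sum.elim_inr, Matrix.smul_apply, smul_eq_mul]
        by_cases hij : i = j
        · subst hij
          simp
        · simp [hij]
    · simp [Fintype.sum_sum_type, mul_comm]
  · -- evaluation at `z = e^{it}`
    have hc := cornerSL_exp_mul_cos t
    have hs := cornerSL_exp_mul_sin t
    generalize Complex.exp (↑t * Complex.I) = z at hc hs ⊢
    have hΔ : ΔX.map (Polynomial.eval z) =
        z • (δ₀ + ((Real.cos t : ℝ) : ℂ) • δ₁ + ((Real.sin t : ℝ) : ℂ) • δ₂) := by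
      ext i j
      simp only [hΔX, Matrix.map_apply, Matrix.add_apply, Matrix.smul_apply, smul_eq_mul,
        Polynomial.eval_add, Polynomial.eval_sub, Polynomial.eval_mul, Polynomial.eval_pow,
        Polynomial.eval_X, Polynomial.eval_C, Polynomial.eval_one]
      linear_combination (δ₁ i j) * hc + (δ₂ i j) * hs
    have hA : (A.map Polynomial.C).map (Polynomial.eval z) = A := by
      ext i j; simp
    have hB : (-B.map Polynomial.C).map (Polynomial.eval z) = -B := by
      ext i j; simp
    have hC : (C.map Polynomial.C).map (Polynomial.eval z) = C := by
      ext i j; simp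
    have h1 : ((Polynomial.X : ℂ[X]) • (1 : Matrix (Fin r) (Fin r) ℂ[X])).map (Polynomial.eval z) =
        z • (1 : Matrix (Fin r) (Fin r) ℂ) := by
      ext i j
      by_cases hij : i = j
      · subst hij
        simp
      · simp [hij]
    have hMz : M.map (Polynomial.eval z) =
        Matrix.fromBlocks 1 0 0 (z • (1 : Matrix (Fin r) (Fin r) ℂ)) *
          Matrix.fromBlocks A (-B) ((δ₀ + ((Real.cos t : ℝ) : ℂ) • δ₁ + ((Real.sin t : ℝ) : ℂ) • δ₂) * C) 1 := by
      rw [hM, Matrix.fromBlocks_map, hA, hB, h1, ← Polynomial.coe_evalRingHom, Matrix.map_mul,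
        Polynomial.coe_evalRingHom, hΔ, hC, Matrix.fromBlocks_multiply]
      simp only [Matrix.one_mul, Matrix.zero_mul, Matrix.mul_one, add_zero, zero_add, Matrix.smul_mul]
    rw [← Polynomial.coe_evalRingHom, RingHom.map_det, RingHom.mapMatrix_apply, Polynomial.coe_evalRingHom,
      hMz, Matrix.det_mul, Matrix.det_fromBlocks_zero₂₁, Matrix.det_one, one_mul, Matrix.det_smul,
      Matrix.det_one, mul_one, Fintype.card_fin, Matrix.det_fromBlocks_one₂₂, Matrix.neg_mul,
      sub_neg_eq_add, Matrix.mul_assoc]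

/-! ### `‖det Γ₅‖ = 1` (`γ₅² = 1` is the landed `gammaFive_mul_self`) -/

/-- The spinor lift of `γ₅` squares to the identity. -/
theorem cornerSL_spinorLift_gammaFive_mul_self {L N : ℕ} [NeZero L] :
    spinorLift (L := L) (N := N) gammaFive * spinorLift (L := L) (N := N) gammaFive = 1 := by
  unfold spinorLift
  rw [← Matrix.mul_kronecker_mul, ← Matrix.mul_kronecker_mul, Matrix.mul_one, Matrix.mul_one,
    gammaFive_mul_self, Matrix.one_kronecker_one, Matrix.one_kronecker_one]

/-- `‖det Γ₅‖ = 1` for the spinor lift of `γ₅`. -/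
theorem cornerSL_norm_det_spinorLift_gammaFive {L N : ℕ} [NeZero L] :
    ‖(spinorLift (L := L) (N := N) gammaFive).det‖ = 1 := by
  have h := congrArg Matrix.det (cornerSL_spinorLift_gammaFive_mul_self (L := L) (N := N))
  rw [Matrix.det_mul, Matrix.det_one] at h
  have h2 := congrArg norm h
  rw [norm_mul, norm_one] at h2
  nlinarith [norm_nonneg (spinorLift (L := L) (N := N) gammaFive).det]

/-! ### The fermion determinant along a one-link circle -/

/-- **One flavour.**  Along a degree-one trigonometric link curve, `‖det D_W(W[e ↦ W(e)c(t)], m₀, 1)‖ =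
‖P(e^{it})‖` for a polynomial `P` of degree `≤ 48`. -/
theorem cornerSL_fermionDet_circle_poly {L : ℕ} [NeZero L] (W : GaugeConfig 4 L SU3) (m₀ : ℝ)
    (z : TorusSite 4 L) (μ : Fin 4) (c : ℝ → SU3) (δ₀ δ₁ δ₂ : Matrix (Fin 3) (Fin 3) ℂ)
    (hc : ∀ t, ((c t : SU3) : Matrix (Fin 3) (Fin 3) ℂ) =
      δ₀ + ((Real.cos t : ℝ) : ℂ) • δ₁ + ((Real.sin t : ℝ) : ℂ) • δ₂) :
    ∃ P : ℂ[X], P.natDegree ≤ 48 ∧ ∀ t : ℝ,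
      ‖fermionDet (wilsonDirac (fundamentalRep (Fin 3)) (Function.update W (z, μ) (W (z, μ) * c t)) m₀ 1)‖ =
        ‖P.eval (Complex.exp (↑t * Complex.I))‖ := by
  obtain ⟨N, A, B, C, Δ₀, Δ₁, Δ₂, hdet⟩ := coareaWegner_oneLinkCircle_detShape W m₀ z μ c δ₀ δ₁ δ₂ hc 0
  obtain ⟨P, hdeg, hev⟩ := cornerSL_exists_poly_det N 24 A B C Δ₀ Δ₁ Δ₂
  refine ⟨P, hdeg, fun t => ?_⟩
  have h1 := hdet t
  rw [sub_zero, Matrix.det_mul] at h1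
  rw [hev t, norm_mul, norm_pow, Complex.norm_exp_ofReal_mul_I, one_pow, one_mul, ← h1, norm_mul,
    cornerSL_norm_det_spinorLift_gammaFive, one_mul]

/-- **All flavours (brick B of S2c).**  Along a degree-one trigonometric link curve the phase-quenched
fermion weight is the modulus of a polynomial on the unit circle:
`∏_f ‖det D_W(W[e ↦ W(e)c(t)], μ_f, 1)‖ = ‖Q(e^{it})‖`, `deg Q ≤ 48 N_f`. -/
theorem cornerSL_prod_fermionDet_circle_poly {L : ℕ} [NeZero L] {Nf : ℕ} (W : GaugeConfig 4 L SU3)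
    (μf : Fin Nf → ℝ) (z : TorusSite 4 L) (μ : Fin 4) (c : ℝ → SU3) (δ₀ δ₁ δ₂ : Matrix (Fin 3) (Fin 3) ℂ)
    (hc : ∀ t, ((c t : SU3) : Matrix (Fin 3) (Fin 3) ℂ) =
      δ₀ + ((Real.cos t : ℝ) : ℂ) • δ₁ + ((Real.sin t : ℝ) : ℂ) • δ₂) :
    ∃ Q : ℂ[X], Q.natDegree ≤ 48 * Nf ∧ ∀ t : ℝ,
      ∏ f, ‖fermionDet (wilsonDirac (fundamentalRep (Fin 3))
          (Function.update W (z, μ) (W (z, μ) * c t)) (μf f) 1)‖ =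
        ‖Q.eval (Complex.exp (↑t * Complex.I))‖ := by
  choose P hPdeg hPev using fun f : Fin Nf => cornerSL_fermionDet_circle_poly W (μf f) z μ c δ₀ δ₁ δ₂ hc
  refine ⟨∏ f, P f, ?_, fun t => ?_⟩
  · calc (∏ f, P f).natDegree ≤ ∑ f, (P f).natDegree := Polynomial.natDegree_prod_le _ _
      _ ≤ ∑ _f : Fin Nf, 48 := Finset.sum_le_sum fun f _ => hPdeg f
      _ = 48 * Nf := by rw [Finset.sum_const, Finset.card_univ, Fintype.card_fin, smul_eq_mul, mul_comm]
  · rw [Polynomial.eval_prod, norm_prod]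
    exact Finset.prod_congr rfl fun f _ => hPev f t

end Summit.QuantumFields.QCD.Cruxes.WindowExtinction.CornerDecorrelationDeepHole

end
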